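import Mathlib

/-!
# Scaled-Bernstein tensors: a reflective positivity checker on the unit box (`NoHeavyLowerTail` cell, stmt-CriticalPhenomena-4575;
# prover `prim-hp-2`, gen 17)

Support file (`--supports stmt-CriticalPhenomena-4575`).  Computable definitions + soundness; no named facts, no sorries.

PURPOSE.  THEOREM B of this line (Kozma–Nitzan goodness with a grandchild ⇒ universal goodness for `|A| = 3` and observer sides of
≤ 4 vertices; memo `run/shared/lean/prim/prim-hp-2/MEMO-gen15-grandchild-certificates.md` §3, `THEOREM-B-grandchild.md`) reduces to
27 polynomial inequalities in 12 variables on `[0,1]¹²`, certified off-line by nonnegative tensor-Bernstein coefficients (1 278 pieces, two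
independent implementations, ttrl lane `hp2b/THMB-BERNSTEIN.md`).  This file is the KERNEL-SIDE checker for such certificates, in the form
that needs no basis transform:

* `Tens n` — a dense coefficient tensor in `n` variables: nested lists of depth `n` with integer leaves; the list at depth `k + 1` is indexed
  by the SCALED-BERNSTEIN index `m` of variable `k`, i.e. it represents `Σ_m T_m · x_k^m (1 - x_k)^(p - m)` with `p + 1` the list length
  (`eval`, via the homogeneous list evaluation `evalL`).
* `ofFn n f` — the multi-affine polynomial with vertex values `f : (ℕ → Bool) → ℤ` (`x_k ↦ true`, `1 - x_k ↦ false`); every input of the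
  certificates is of this form (an expectation of an integer function of independent Bernoulli bits); `lift` = degree 0 in a new outer variable.
* `add`, `smul`, `sub`, `mul` — sum, integer multiple, difference, and PRODUCT (= convolution of scaled-Bernstein coefficients, `mulL`);
  `add_spec`, `smul_spec`, `mul_spec`: on well-formed tensors (`WF n ds`: uniform list lengths `d_k + 1`) `eval` is a ring homomorphism.
* `allNonneg` — all leaves `≥ 0`; `eval_nonneg`: then `eval T x ≥ 0` for every `x ∈ [0,1]ⁿ` (each basis product is `≥ 0`).
So a certificate for `F ≥ 0` on the box, `F` a ±-combination of products of multi-affine polynomials, is ONE Boolean `allNonneg` of a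
computed tensor (evaluated by `native_decide` in the customer files `…KNGoodGMgcCert*`), and the soundness is this file.
[folklore: Bernstein / Pólya positivity certificates; the scaled basis `x^m (1-x)^(p-m)` makes products coefficient convolutions]
-/

namespace Summit.CriticalPhenomena.PercolationContinuityZ3.Theorems

namespace SBTens

/-! ## Data -/

/-- Dense coefficient tensors in `n` variables: depth-`n` nested lists with integer leaves (level `k+1` = scaled-Bernstein index of
variable `k`). [folklore] -/
def Tens : ℕ → Type
  | 0 => ℤ
  | n + 1 => List (Tens n)

/-- A leaf. [folklore] -/
@[inline] def ofInt (a : ℤ) : Tens 0 := a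
/-- The integer of a leaf. [folklore] -/
@[inline] def toInt (a : Tens 0) : ℤ := a
/-- A node from its list of sub-tensors. [folklore] -/
@[inline] def ofList {n : ℕ} (l : List (Tens n)) : Tens (n + 1) := l
/-- The list of sub-tensors of a node. [folklore] -/
@[inline] def toList {n : ℕ} (A : Tens (n + 1)) : List (Tens n) := A

/-- `toInt ∘ ofInt = id`. [folklore] -/
@[simp] theorem toInt_ofInt (a : ℤ) : toInt (ofInt a) = a := rfl
/-- `toList ∘ ofList = id`. [folklore] -/
@[simp] theorem toList_ofList {n : ℕ} (l : List (Tens n)) : toList (ofList l) = l := rfl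

/-! ## Generic one-variable layer: homogeneous evaluation, long zip, convolution -/

section Generic
variable {α β γ : Type}

/-- Homogeneous evaluation of a coefficient list: `evalL ev x y [c₀,…,c_p] = Σ_m ev c_m · x^m · y^(p-m)`. [folklore] -/
noncomputable def evalL (ev : α → ℝ) (x y : ℝ) : List α → ℝ
  | [] => 0
  | c :: C => ev c * y ^ C.length + x * evalL ev x y C

/-- `evalL` of the empty list. [folklore] -/
@[simp] theorem evalL_nil (ev : α → ℝ) (x y : ℝ) : evalL ev x y [] = 0 := rfl
/-- `evalL` of a cons. [folklore] -/
@[simp] theorem evalL_cons (ev : α → ℝ) (x y : ℝ) (c : α) (C : List α) :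
    evalL ev x y (c :: C) = ev c * y ^ C.length + x * evalL ev x y C := rfl

/-- Pointwise combination keeping the longer tail. [folklore] -/
def zipLong (f : γ → γ → γ) : List γ → List γ → List γ
  | [], R => R
  | c :: C, [] => c :: C
  | c :: C, r :: R => f c r :: zipLong f C R

/-- `zipLong` with empty left argument. [folklore] -/
@[simp] theorem zipLong_nil_left (f : γ → γ → γ) (R : List γ) : zipLong f [] R = R := by cases R <;> rfl
/-- `zipLong` with empty right argument. [folklore] -/
@[simp] theorem zipLong_cons_nil (f : γ → γ → γ) (c : γ) (C : List γ) : zipLong f (c :: C) [] = c :: C := rfl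
/-- `zipLong` of two conses. [folklore] -/
@[simp] theorem zipLong_cons_cons (f : γ → γ → γ) (c r : γ) (C R : List γ) :
    zipLong f (c :: C) (r :: R) = f c r :: zipLong f C R := rfl

/-- Product of coefficient lists (convolution): `(a·y^p + x·A) · B = a·y^p·B + x·(A·B)`. [folklore] -/
def mulL (mul : α → β → γ) (add : γ → γ → γ) : List α → List β → List γ
  | [], _ => []
  | [a], B => B.map (mul a)
  | a :: a' :: A, B =>
    match B.map (mul a) with
    | [] => []
    | c :: C => c :: zipLong add C (mulL mul add (a' :: A) B)

/-- `mulL` with a singleton left factor. [folklore] -/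
theorem mulL_single (mul : α → β → γ) (add : γ → γ → γ) (a : α) (B : List β) :
    mulL mul add [a] B = B.map (mul a) := rfl
/-- `mulL` unfolding for a left factor of length `≥ 2`. [folklore] -/
theorem mulL_cons_cons (mul : α → β → γ) (add : γ → γ → γ) (a a' : α) (A : List α) (b : β) (B : List β) :
    mulL mul add (a :: a' :: A) (b :: B) = mul a b :: zipLong add (B.map (mul a)) (mulL mul add (a' :: A) (b :: B)) := rfl

variable (x y : ℝ)

/-- Evaluation is nonnegative when all coefficients evaluate nonnegatively and `x, y ≥ 0`. [folklore] -/
theorem evalL_nonneg (ev : α → ℝ) (hx : 0 ≤ x) (hy : 0 ≤ y) :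
    ∀ C : List α, (∀ c ∈ C, 0 ≤ ev c) → 0 ≤ evalL ev x y C
  | [], _ => le_rfl
  | c :: C, h => by
    rw [evalL_cons]
    have h1 : 0 ≤ ev c := h c (by simp)
    have h2 : 0 ≤ evalL ev x y C := evalL_nonneg ev hx hy C fun c' hc' => h c' (by simp [hc'])
    positivity

/-- Evaluation of a mapped list under a map that scales values. [folklore] -/
theorem evalL_map (evβ : β → ℝ) (evγ : γ → ℝ) (g : β → γ) (k : ℝ) :
    ∀ B : List β, (∀ b ∈ B, evγ (g b) = k * evβ b) → evalL evγ x y (B.map g) = k * evalL evβ x y B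
  | [], _ => by simp
  | b :: B, h => by
    rw [List.map_cons, evalL_cons, evalL_cons, List.length_map, h b (by simp),
      evalL_map evβ evγ g k B fun b' hb' => h b' (by simp [hb'])]
    ring

/-- Evaluation of a long zip under an additive combination (values tracked through an invariant `P`). [folklore] -/
theorem evalL_zipLong (P : γ → Prop) (ev : γ → ℝ) (add : γ → γ → γ)
    (hadd : ∀ c c', P c → P c' → P (add c c') ∧ ev (add c c') = ev c + ev c') :
    ∀ C R : List γ, C.length ≤ R.length → (∀ c ∈ C, P c) → (∀ r ∈ R, P r) →
      (∀ e ∈ zipLong add C R, P e) ∧ (zipLong add C R).length = R.length ∧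
        evalL ev x y (zipLong add C R) = y ^ (R.length - C.length) * evalL ev x y C + evalL ev x y R
  | [], R, _, _, hR => ⟨by simpa using hR, by simp, by simp⟩
  | c :: C, [], h, _, _ => by simp at h
  | c :: C, r :: R, h, hC, hR => by
    have hlen : C.length ≤ R.length := by simpa using h
    obtain ⟨hP, hl, hev⟩ := evalL_zipLong P ev add hadd C R hlen (fun c' hc' => hC c' (by simp [hc']))
      (fun r' hr' => hR r' (by simp [hr']))
    obtain ⟨hPcr, hevcr⟩ := hadd c r (hC c (by simp)) (hR r (by simp))
    refine ⟨?_, ?_, ?_⟩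
    · intro e he
      rw [zipLong_cons_cons, List.mem_cons] at he
      rcases he with rfl | he
      · exact hPcr
      · exact hP e he
    · simp [hl]
    · rw [zipLong_cons_cons, evalL_cons, evalL_cons, evalL_cons, hl, hev, hevcr]
      have hRC : R.length + 1 - (C.length + 1) = R.length - C.length := by omega
      simp only [List.length_cons, hRC]
      have hpow : y ^ R.length = y ^ (R.length - C.length) * y ^ C.length := by
        rw [← pow_add, Nat.sub_add_cancel hlen]
      rw [hpow]
      ring

/-- The convolution computes the product: invariants `Pα, Pβ, Pγ` with `mul`/`add` homomorphic on them. [folklore] -/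
theorem mulL_spec (Pα : α → Prop) (Pβ : β → Prop) (Pγ : γ → Prop) (evα : α → ℝ) (evβ : β → ℝ) (evγ : γ → ℝ)
    (mul : α → β → γ) (add : γ → γ → γ)
    (hmul : ∀ a b, Pα a → Pβ b → Pγ (mul a b) ∧ evγ (mul a b) = evα a * evβ b)
    (hadd : ∀ c c', Pγ c → Pγ c' → Pγ (add c c') ∧ evγ (add c c') = evγ c + evγ c') :
    ∀ (A : List α) (B : List β), A ≠ [] → B ≠ [] → (∀ a ∈ A, Pα a) → (∀ b ∈ B, Pβ b) →
      (∀ e ∈ mulL mul add A B, Pγ e) ∧ (mulL mul add A B).length + 1 = A.length + B.length ∧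
        evalL evγ x y (mulL mul add A B) = evalL evα x y A * evalL evβ x y B
  | [], _, hA, _, _, _ => absurd rfl hA
  | _, [], _, hB, _, _ => absurd rfl hB
  | [a], b :: B, _, _, hA, hB => by
    have ha : Pα a := hA a (by simp)
    refine ⟨?_, ?_, ?_⟩
    · intro e he
      rw [mulL_single, List.mem_map] at he
      obtain ⟨b', hb', rfl⟩ := he
      exact (hmul a b' ha (hB b' hb')).1
    · simp only [mulL_single, List.length_map, List.length_cons, List.length_nil]; omega
    · rw [mulL_single, evalL_map x y evβ evγ (mul a) (evα a) (b :: B) fun b' hb' => (hmul a b' ha (hB b' hb')).2]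
      simp
  | a :: a' :: A, b :: B, _, _, hA, hB => by
    have ha : Pα a := hA a (by simp)
    obtain ⟨hP, hl, hev⟩ := mulL_spec Pα Pβ Pγ evα evβ evγ mul add hmul hadd (a' :: A) (b :: B) (by simp) (by simp)
      (fun e he => hA e (by simp at he ⊢; tauto)) hB
    have hlen : (B.map (mul a)).length ≤ (mulL mul add (a' :: A) (b :: B)).length := by
      simp only [List.length_map, List.length_cons] at hl ⊢; omega
    have hPC : ∀ c ∈ B.map (mul a), Pγ c := by
      intro c hc; rw [List.mem_map] at hc; obtain ⟨b', hb', rfl⟩ := hc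
      exact (hmul a b' ha (hB b' (by simp [hb']))).1
    obtain ⟨hP2, hl2, hev2⟩ := evalL_zipLong x y Pγ evγ add hadd _ _ hlen hPC hP
    obtain ⟨hPab, hevab⟩ := hmul a b ha (hB b (by simp))
    refine ⟨?_, ?_, ?_⟩
    · intro e he
      rw [mulL_cons_cons, List.mem_cons] at he
      rcases he with rfl | he
      · exact hPab
      · exact hP2 e he
    · rw [mulL_cons_cons, List.length_cons, hl2]
      simp only [List.length_cons] at hl ⊢; omega
    · rw [mulL_cons_cons, evalL_cons, hl2, hev2, hev, hevab,
        evalL_map x y evβ evγ (mul a) (evα a) B fun b' hb' => (hmul a b' ha (hB b' (by simp [hb']))).2]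
      have hRl : (mulL mul add (a' :: A) (b :: B)).length = A.length + 1 + B.length := by
        simp only [List.length_cons] at hl; omega
      rw [hRl, List.length_map]
      have hsub : A.length + 1 + B.length - B.length = A.length + 1 := by omega
      rw [hsub]
      simp only [evalL_cons, List.length_cons]
      ring

end Generic

/-! ## Tensor operations -/

/-- Sum (shapes must agree). [folklore] -/
def add : (n : ℕ) → Tens n → Tens n → Tens n
  | 0, a, b => ofInt (toInt a + toInt b)
  | n + 1, A, B => ofList (zipLong (add n) (toList A) (toList B))

/-- Integer multiple. [folklore] -/
def smul : (n : ℕ) → ℤ → Tens n → Tens n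
  | 0, k, a => ofInt (k * toInt a)
  | n + 1, k, A => ofList ((toList A).map (smul n k))

/-- Difference (shapes must agree). [folklore] -/
def sub (n : ℕ) (A B : Tens n) : Tens n := add n A (smul n (-1) B)

/-- Product (convolution of scaled-Bernstein coefficients; formal degrees add). [folklore] -/
def mul : (n : ℕ) → Tens n → Tens n → Tens n
  | 0, a, b => ofInt (toInt a * toInt b)
  | n + 1, A, B => ofList (mulL (mul n) (add n) (toList A) (toList B))

/-- All leaves are `≥ 0`. [folklore] -/
def allNonneg : (n : ℕ) → Tens n → Bool
  | 0, a => decide (0 ≤ toInt a)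
  | n + 1, A => (toList A).all (allNonneg n)

/-- The multi-affine tensor with vertex values `f` (bit `k` of the vertex ↔ variable `k`; index 0 ↔ `1 - x_k`, index 1 ↔ `x_k`). [folklore] -/
def ofFn : (n : ℕ) → ((ℕ → Bool) → ℤ) → Tens n
  | 0, f => ofInt (f fun _ => false)
  | n + 1, f => ofList [ofFn n (fun c => f (Function.update c n false)), ofFn n (fun c => f (Function.update c n true))]

/-- Degree `0` in a new outermost variable. [folklore] -/
def lift {n : ℕ} (T : Tens n) : Tens (n + 1) := ofList [T]

/-- Well-formedness check: uniform shape `ds = [d_{n-1}, …, d_0]` (outermost first), every list at the level of variable `k` has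
length `d_k + 1`. [folklore] -/
def wf : (n : ℕ) → List ℕ → Tens n → Bool
  | 0, ds, _ => ds.isEmpty
  | _ + 1, [], _ => false
  | n + 1, d :: ds, A => ((toList A).length == d + 1) && (toList A).all (wf n ds)

/-- Well-formedness as a proposition. [folklore] -/
abbrev WF (n : ℕ) (ds : List ℕ) (T : Tens n) : Prop := wf n ds T = true

/-- Evaluation at `x : ℕ → ℝ` (variable `k` ↦ `x k`). [folklore] -/
noncomputable def eval : (n : ℕ) → Tens n → (ℕ → ℝ) → ℝ
  | 0, a, _ => (toInt a : ℝ)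
  | n + 1, A, x => evalL (fun c => eval n c x) (x n) (1 - x n) (toList A)

/-! ## Soundness -/

/-- Well-formedness at depth `0`. [folklore] -/
theorem WF_zero (ds : List ℕ) (a : Tens 0) : WF 0 ds a ↔ ds = [] := by simp [WF, wf, List.isEmpty_iff]
/-- Well-formedness at depth `n+1`. [folklore] -/
theorem WF_succ (n d : ℕ) (ds : List ℕ) (A : Tens (n + 1)) :
    WF (n + 1) (d :: ds) A ↔ (toList A).length = d + 1 ∧ ∀ a ∈ toList A, WF n ds a := by
  simp [WF, wf, Bool.and_eq_true, List.all_eq_true]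
/-- No tensor of positive depth is well formed for the empty shape. [folklore] -/
theorem WF_succ_nil (n : ℕ) (A : Tens (n + 1)) : ¬ WF (n + 1) [] A := by simp [WF, wf]

/-- `add` preserves shape and evaluates to the sum. [folklore] -/
theorem add_spec : ∀ (n : ℕ) (ds : List ℕ) (A B : Tens n), WF n ds A → WF n ds B →
    WF n ds (add n A B) ∧ ∀ x, eval n (add n A B) x = eval n A x + eval n B x
  | 0, ds, a, b, hA, _ => ⟨(WF_zero _ _).2 ((WF_zero _ _).1 hA), fun x => by simp [add, eval]⟩
  | n + 1, [], A, B, hA, _ => absurd hA (WF_succ_nil n A)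
  | n + 1, d :: ds, A, B, hA, hB => by
    rw [WF_succ] at hA hB
    have key := fun x => evalL_zipLong (x n) (1 - x n) (WF n ds) (fun c => eval n c x) (add n)
      (fun c c' hc hc' => ⟨(add_spec n ds c c' hc hc').1, (add_spec n ds c c' hc hc').2 x⟩)
      (toList A) (toList B) (by rw [hA.1, hB.1]) hA.2 hB.2
    refine ⟨(WF_succ _ _ _ _).2 ⟨?_, (key 0).1⟩, fun x => ?_⟩
    · show (zipLong (add n) (toList A) (toList B)).length = d + 1
      rw [(key 0).2.1, hB.1]
    · show evalL (fun c => eval n c x) (x n) (1 - x n) (zipLong (add n) (toList A) (toList B)) = _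
      rw [(key x).2.2, hA.1, hB.1, Nat.sub_self, pow_zero, one_mul]
      rfl

/-- `smul` preserves shape and scales the value. [folklore] -/
theorem smul_spec : ∀ (n : ℕ) (ds : List ℕ) (k : ℤ) (A : Tens n), WF n ds A →
    WF n ds (smul n k A) ∧ ∀ x, eval n (smul n k A) x = (k : ℝ) * eval n A x
  | 0, ds, k, a, hA => ⟨(WF_zero _ _).2 ((WF_zero _ _).1 hA), fun x => by simp [smul, eval]⟩
  | n + 1, [], k, A, hA => absurd hA (WF_succ_nil n A)
  | n + 1, d :: ds, k, A, hA => by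
    rw [WF_succ] at hA
    refine ⟨(WF_succ _ _ _ _).2 ⟨?_, ?_⟩, fun x => ?_⟩
    · show ((toList A).map (smul n k)).length = d + 1
      rw [List.length_map, hA.1]
    · show ∀ a ∈ (toList A).map (smul n k), WF n ds a
      intro a ha; rw [List.mem_map] at ha; obtain ⟨a', ha', rfl⟩ := ha
      exact (smul_spec n ds k a' (hA.2 a' ha')).1
    · show evalL (fun c => eval n c x) (x n) (1 - x n) ((toList A).map (smul n k)) = _
      exact evalL_map (x n) (1 - x n) (fun c => eval n c x) (fun c => eval n c x) (smul n k) (k : ℝ) (toList A)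
        fun a ha => (smul_spec n ds k a (hA.2 a ha)).2 x

/-- `sub` preserves shape and evaluates to the difference. [folklore] -/
theorem sub_spec (n : ℕ) (ds : List ℕ) (A B : Tens n) (hA : WF n ds A) (hB : WF n ds B) :
    WF n ds (sub n A B) ∧ ∀ x, eval n (sub n A B) x = eval n A x - eval n B x := by
  obtain ⟨hB', hBe⟩ := smul_spec n ds (-1) B hB
  obtain ⟨hS, hSe⟩ := add_spec n ds A _ hA hB'
  exact ⟨hS, fun x => by rw [sub, hSe, hBe]; push_cast; ring⟩

/-- `mul` adds shapes and evaluates to the product. [folklore] -/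
theorem mul_spec : ∀ (n : ℕ) (ds ds' : List ℕ) (A B : Tens n), ds.length = n → ds'.length = n → WF n ds A → WF n ds' B →
    WF n (List.zipWith (· + ·) ds ds') (mul n A B) ∧ ∀ x, eval n (mul n A B) x = eval n A x * eval n B x
  | 0, ds, ds', a, b, hds, _, _, _ =>
    ⟨by rw [List.length_eq_zero_iff] at hds; subst hds; exact (WF_zero _ _).2 (by simp), fun x => by simp [mul, eval]⟩
  | n + 1, [], _, A, B, hds, _, _, _ => by simp at hds
  | n + 1, _ :: _, [], A, B, _, hds', _, _ => by simp at hds'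
  | n + 1, d :: ds, d' :: ds', A, B, hds, hds', hA, hB => by
    rw [WF_succ] at hA hB
    simp only [List.length_cons, Nat.add_right_cancel_iff] at hds hds'
    have hAne : toList A ≠ [] := List.ne_nil_of_length_eq_add_one hA.1
    have hBne : toList B ≠ [] := List.ne_nil_of_length_eq_add_one hB.1
    have key := fun x => mulL_spec (x n) (1 - x n) (WF n ds) (WF n ds') (WF n (List.zipWith (· + ·) ds ds'))
      (fun c => eval n c x) (fun c => eval n c x) (fun c => eval n c x) (mul n) (add n)
      (fun a b ha hb => ⟨(mul_spec n ds ds' a b hds hds' ha hb).1, (mul_spec n ds ds' a b hds hds' ha hb).2 x⟩)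
      (fun c c' hc hc' => ⟨(add_spec n _ c c' hc hc').1, (add_spec n _ c c' hc hc').2 x⟩)
      (toList A) (toList B) hAne hBne hA.2 hB.2
    refine ⟨?_, fun x => ?_⟩
    · show WF (n + 1) ((d + d') :: List.zipWith (· + ·) ds ds') (ofList (mulL (mul n) (add n) (toList A) (toList B)))
      rw [WF_succ, toList_ofList]
      refine ⟨?_, (key 0).1⟩
      have := (key 0).2.1
      rw [hA.1, hB.1] at this; omega
    · show evalL (fun c => eval n c x) (x n) (1 - x n) (mulL (mul n) (add n) (toList A) (toList B)) = _
      exact (key x).2.2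

/-- All coefficients `≥ 0` ⇒ the tensor is `≥ 0` on the unit box (no well-formedness needed). [folklore] -/
theorem eval_nonneg : ∀ (n : ℕ) (T : Tens n) (x : ℕ → ℝ), (∀ i, 0 ≤ x i ∧ x i ≤ 1) → allNonneg n T = true → 0 ≤ eval n T x
  | 0, a, x, _, h => by
    simp only [allNonneg, decide_eq_true_eq] at h
    simp only [eval]; exact_mod_cast h
  | n + 1, A, x, hx, h => by
    simp only [allNonneg, List.all_eq_true] at h
    exact evalL_nonneg (x n) (1 - x n) _ (hx n).1 (sub_nonneg.2 (hx n).2) (toList A)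
      fun c hc => eval_nonneg n c x hx (h c hc)

/-- `ofFn` is well formed of shape `[1,…,1]`. [folklore] -/
theorem WF_ofFn : ∀ (n : ℕ) (f : (ℕ → Bool) → ℤ), WF n (List.replicate n 1) (ofFn n f)
  | 0, f => (WF_zero _ _).2 rfl
  | n + 1, f => by
    rw [List.replicate_succ, WF_succ]
    refine ⟨rfl, ?_⟩
    intro a ha
    simp only [ofFn, toList_ofList, List.mem_cons, List.not_mem_nil, or_false] at ha
    rcases ha with rfl | rfl <;> exact WF_ofFn n _

/-- Evaluation of `ofFn` — base case. [folklore] -/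
theorem eval_ofFn_zero (f : (ℕ → Bool) → ℤ) (x : ℕ → ℝ) : eval 0 (ofFn 0 f) x = (f fun _ => false : ℝ) := rfl

/-- Evaluation of `ofFn` — the Bernoulli recursion in the outermost variable. [folklore] -/
theorem eval_ofFn_succ (n : ℕ) (f : (ℕ → Bool) → ℤ) (x : ℕ → ℝ) :
    eval (n + 1) (ofFn (n + 1) f) x =
      (1 - x n) * eval n (ofFn n fun c => f (Function.update c n false)) x +
        x n * eval n (ofFn n fun c => f (Function.update c n true)) x := by
  simp only [eval, ofFn, toList_ofList, evalL_cons, evalL_nil, List.length_cons, List.length_nil]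
  ring

/-- `lift` is well formed with outer degree `0`. [folklore] -/
theorem WF_lift (n : ℕ) (ds : List ℕ) (T : Tens n) (h : WF n ds T) : WF (n + 1) (0 :: ds) (lift T) :=
  (WF_succ _ _ _ _).2 ⟨rfl, fun a ha => by
    simp only [lift, toList_ofList, List.mem_singleton] at ha; subst ha; exact h⟩

/-- `lift` does not change the value. [folklore] -/
theorem eval_lift (n : ℕ) (T : Tens n) (x : ℕ → ℝ) : eval (n + 1) (lift T) x = eval n T x := by
  simp [eval, lift, evalL]

/-- **Certificate soundness in one line**: a tensor with all scaled-Bernstein coefficients `≥ 0` is `≥ 0` on `[0,1]ⁿ`. [folklore] -/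
theorem nonneg_of_allNonneg (n : ℕ) (T : Tens n) (h : allNonneg n T = true) (x : ℕ → ℝ)
    (hx : ∀ i, 0 ≤ x i ∧ x i ≤ 1) : 0 ≤ eval n T x :=
  eval_nonneg n T x hx h

end SBTens

end Summit.CriticalPhenomena.PercolationContinuityZ3.Theorems
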